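import Summits.AnomalousDissipation.AnomalousDissipation.Theorems.TaylorGreenLoudGalerkinStates.Negative.LoadBearing
import Literature.Probability.RandomFractals.SecondMomentDimension

/-!
# Sketch — crux-ideate stmt-AnomalousDissipation-2986 (MirrorVariety.GalerkinSteadyZerothLaw), ideator 1, round 1

First lemmas of the two idea cards `loud-fraction-pigeonhole-rice-census` and `ray-bordered-newton-race`.
Vocabulary is the landed one of `Theorems/TaylorGreenLoudGalerkinStates/Negative/LoadBearing.lean`
(`IsSteadyState ν N f U` = verbatim the state bracket of the crux).
-/

noncomputable section

open scoped InnerProductSpace Topology ENNReal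
open MeasureTheory Filter Set
open Literature.Analysis.FunctionSpaces Literature.Analysis.FunctionSpaces.Torus
open Summit.AnomalousDissipation.AnomalousDissipation.Theorems.TaylorGreenLoudGalerkinStates.Negative
  (IsSteadyState IsBandLimited)
open Summit.AnomalousDissipation.AnomalousDissipation.Theses.MirrorVariety (GalerkinSteadyZerothLaw)

namespace Summit.AnomalousDissipation.AnomalousDissipation.Cruxes.GalerkinSteadyZerothLaw.Ideator1

local notation "𝕋³" => UnitAddTorus (Fin 3)
local notation "E³" => EuclideanSpace ℝ (Fin 3)

/-! ## §0 Vocabulary -/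

/-- Admissible force of the crux: smooth, divergence free, mean zero. -/
def IsAdmissibleForce (f : 𝕋³ → E³) : Prop := IsSmooth f ∧ IsDivFree f ∧ HasZeroMean f

/-- "`f` is loud at `(ν, N)` with budgets `(E, ε)`": a loud bounded Galerkin steady state exists —
verbatim the `∃ U, …` clause of the crux. -/
def HasLoudState (ν : ℝ) (N : ℕ) (E ε : ℝ) (f : 𝕋³ → E³) : Prop :=
  ∃ U : 𝕋³ → E³, IsSteadyState ν N f U ∧ ∫ x, ‖U x‖ ^ 2 ≤ E ∧ ε ≤ ν * gradNormSq U

/-- The crux in this vocabulary (definitional). -/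
theorem crux_iff :
    GalerkinSteadyZerothLaw ↔
      ∃ f : 𝕋³ → E³, IsSmooth f ∧ IsDivFree f ∧ HasZeroMean f ∧
        ∃ (ν : ℕ → ℝ) (E ε : ℝ), (∀ j, 0 < ν j) ∧ Tendsto ν atTop (𝓝 0) ∧ 0 < ε ∧
          ∀ j, ∃ᶠ N in atTop, HasLoudState (ν j) N E ε f :=
  Iff.rfl

/-! ## §1 Card `loud-fraction-pigeonhole-rice-census`: the two transfer lemmas (C⁺ ⇒ crux) -/

/-- C⁺ (finite menu): finitely many FIXED admissible forces such that at every level `j`, for infinitely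
many resolutions `N`, at least one menu item carries a loud bounded Galerkin steady state. -/
def MenuLoud : Prop :=
  ∃ (m : ℕ) (F : Fin (m + 1) → 𝕋³ → E³), (∀ i, IsAdmissibleForce (F i)) ∧
    ∃ (ν : ℕ → ℝ) (E ε : ℝ), (∀ j, 0 < ν j) ∧ Tendsto ν atTop (𝓝 0) ∧ 0 < ε ∧
      ∀ j, ∃ᶠ N in atTop, ∃ i, HasLoudState (ν j) N E ε (F i)

/-- C⁺ (positive fraction): a FIXED probability space of admissible forces in which, at every level `j`
and for infinitely many `N`, the loud forces have measure `≥ p > 0` (which forces are loud may wander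
with `(j, N)`). -/
def PositiveFractionLoud : Prop :=
  ∃ (ι : Type) (_ : MeasurableSpace ι) (μ : Measure ι) (_ : IsProbabilityMeasure μ) (F : ι → 𝕋³ → E³),
    (∀ i, IsAdmissibleForce (F i)) ∧
    ∃ (ν : ℕ → ℝ) (E ε : ℝ) (p : ℝ≥0∞), (∀ j, 0 < ν j) ∧ Tendsto ν atTop (𝓝 0) ∧ 0 < ε ∧ 0 < p ∧
      (∀ j N, MeasurableSet {i | HasLoudState (ν j) N E ε (F i)}) ∧
      ∀ j, ∃ᶠ N in atTop, p ≤ μ {i | HasLoudState (ν j) N E ε (F i)}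

/-- Subsequence bookkeeping shared by both transfers: from ONE force loud infinitely often in `N` at
infinitely many levels `j`, the crux. [folklore] -/
theorem crux_of_frequently_levels {f : 𝕋³ → E³} (hf : IsAdmissibleForce f) {ν : ℕ → ℝ} {E ε : ℝ}
    (hν : ∀ j, 0 < ν j) (hν0 : Tendsto ν atTop (𝓝 0)) (hε : 0 < ε)
    (h : {j | ∃ᶠ N in atTop, HasLoudState (ν j) N E ε f}.Infinite) : GalerkinSteadyZerothLaw := by
  set ψ := Nat.nth (fun j => ∃ᶠ N in atTop, HasLoudState (ν j) N E ε f) with hψ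
  have hmono : StrictMono ψ := Nat.nth_strictMono h
  have hmem : ∀ n, ∃ᶠ N in atTop, HasLoudState (ν (ψ n)) N E ε f := fun n => Nat.nth_mem_of_infinite h n
  exact ⟨f, hf.1, hf.2.1, hf.2.2, ν ∘ ψ, E, ε, fun n => hν _, hν0.comp hmono.tendsto_atTop, hε, hmem⟩

/-- **Finite-menu pigeonhole transfer**: `MenuLoud → crux`. [folklore] -/
theorem menu_transfer : MenuLoud → GalerkinSteadyZerothLaw := by
  rintro ⟨m, F, hF, ν, E, ε, hν, hν0, hε, h⟩
  -- at each level some fixed item is loud for infinitely many N (finite ∀ commutes with ∀ᶠ)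
  have h1 : ∀ j, ∃ i, ∃ᶠ N in atTop, HasLoudState (ν j) N E ε (F i) := by
    intro j
    by_contra hcon
    have hcon' : ∀ i, ∀ᶠ N in atTop, ¬ HasLoudState (ν j) N E ε (F i) := fun i =>
      Filter.not_frequently.1 fun hfr => hcon ⟨i, hfr⟩
    have hall : ∀ᶠ N in atTop, ∀ i, ¬ HasLoudState (ν j) N E ε (F i) :=
      Filter.eventually_all.2 hcon'
    obtain ⟨N, ⟨i, hi⟩, hno⟩ := ((h j).and_eventually hall).exists
    exact hno i hi
  choose i hi using h1
  -- some item is chosen at infinitely many levels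
  obtain ⟨i₀, hi₀⟩ := Finite.exists_infinite_fiber i
  have hinf : {j | i j = i₀}.Infinite := Set.infinite_coe_iff.1 hi₀
  have hsub : {j | i j = i₀} ⊆ {j | ∃ᶠ N in atTop, HasLoudState (ν j) N E ε (F i₀)} := by
    intro j hj
    have hj' : i j = i₀ := hj
    have := hi j
    rw [hj'] at this
    exact this
  exact crux_of_frequently_levels (hF i₀) hν hν0 hε (hinf.mono hsub)

/-- **Positive-fraction (reverse Fatou) transfer**: `PositiveFractionLoud → crux`. Double use of
`μ(limsup Eₙ) ≥ inf μ(Eₙ)` (tree: `Literature.Probability.RandomFractals.le_measure_limsup`), first in `N`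
at fixed level, then in the level; the quantifier shape `∀ j, ∃ᶠ N` of the crux is exactly what comes out. [folklore] -/
theorem fraction_transfer : PositiveFractionLoud → GalerkinSteadyZerothLaw := by
  rintro ⟨ι, _, μ, _, F, hF, ν, E, ε, p, hν, hν0, hε, hp, hmeas, hfreq⟩
  -- Step 1: at each level j, the forces loud for infinitely many N contain a measurable set of measure ≥ p.
  have step1 : ∀ j, ∃ S : Set ι, MeasurableSet S ∧ p ≤ μ S ∧
      ∀ i ∈ S, ∃ᶠ N in atTop, HasLoudState (ν j) N E ε (F i) := by
    intro j
    have hinf : {N | p ≤ μ {i | HasLoudState (ν j) N E ε (F i)}}.Infinite :=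
      Nat.frequently_atTop_iff_infinite.1 (hfreq j)
    set φ := Nat.nth (fun N => p ≤ μ {i | HasLoudState (ν j) N E ε (F i)}) with hφ
    have hφmono : StrictMono φ := Nat.nth_strictMono hinf
    have hφmem : ∀ n, p ≤ μ {i | HasLoudState (ν j) (φ n) E ε (F i)} := fun n =>
      Nat.nth_mem_of_infinite hinf n
    refine ⟨⋂ m, ⋃ n, ⋃ (_ : m ≤ n), {i | HasLoudState (ν j) (φ n) E ε (F i)}, ?_, ?_, ?_⟩
    · exact MeasurableSet.iInter fun m => MeasurableSet.iUnion fun n =>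
        MeasurableSet.iUnion fun _ => hmeas j (φ n)
    · exact Literature.Probability.RandomFractals.le_measure_limsup (P := μ)
        (E := fun n => {i | HasLoudState (ν j) (φ n) E ε (F i)}) (fun n => hmeas j (φ n)) hφmem
    · intro i hi
      simp only [mem_iInter, mem_iUnion, mem_setOf_eq] at hi
      rw [Nat.frequently_atTop_iff_infinite]
      refine Set.infinite_of_forall_exists_gt fun a => ?_
      obtain ⟨n, hn, hP⟩ := hi (a + 1)
      exact ⟨φ n, hP, lt_of_lt_of_le (Nat.lt_of_lt_of_le (Nat.lt_succ_self a) hn) (hφmono.id_le n)⟩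
  choose S hSmeas hSge hSfreq using step1
  -- Step 2: some force lies in S j for infinitely many j.
  have h2 := Literature.Probability.RandomFractals.le_measure_limsup (P := μ) (E := S) hSmeas hSge
  have hpos : μ (⋂ m, ⋃ n, ⋃ (_ : m ≤ n), S n) ≠ 0 := (hp.trans_le h2).ne'
  obtain ⟨i, hi⟩ := nonempty_of_measure_ne_zero hpos
  simp only [mem_iInter, mem_iUnion] at hi
  have hTinf : {j | ∃ᶠ N in atTop, HasLoudState (ν j) N E ε (F i)}.Infinite := by
    refine Set.infinite_of_forall_exists_gt fun a => ?_
    obtain ⟨n, hn, hmemS⟩ := hi (a + 1)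
    exact ⟨n, hSfreq n i hmemS, Nat.lt_of_lt_of_le (Nat.lt_succ_self a) hn⟩
  exact crux_of_frequently_levels (hF i) hν hν0 hε hTinf

/-! ## §1b The midpoint–chord identity of a quadratic map (second Rice moment: states sharing a force) -/

/-- For `Φ c = L c + B c c` (linear + quadratic, `B` NOT assumed symmetric):
`Φ c − Φ c' = DΦ(m)(c − c')` EXACTLY, with `m = (c + c')/2` and `DΦ(m) w = L w + B m w + B w m`.
Hence two Galerkin steady states share force and viscosity iff their difference lies in the kernel of the
linearisation at their midpoint. [folklore] -/
theorem midpoint_chord {X : Type*} [AddCommGroup X] [Module ℝ X]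
    (L : X →ₗ[ℝ] X) (B : X →ₗ[ℝ] X →ₗ[ℝ] X) (c c' : X) :
    (L c + B c c) - (L c' + B c' c') =
      L (c - c') + B ((1 / 2 : ℝ) • (c + c')) (c - c') + B (c - c') ((1 / 2 : ℝ) • (c + c')) := by
  simp only [map_add, map_sub, map_smul, LinearMap.add_apply, LinearMap.sub_apply,
    LinearMap.smul_apply]
  module

/-! ## §2 Card `ray-bordered-newton-race`: the designer aims at the RAY `ℝ₊ f` (amplitude is absorbed into ν) -/

/-- **Ray absorption** (exact scaling covariance `(A f, ν, U) ↦ (f, ν/√A, U/√A)` at the Galerkin level):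
an admissible steady state for the force `A • f` at `(ν, N)` is, after division by `√A`, an admissible
steady state for `f` at `(ν/√A, N)`; energy scales by `A⁻¹`, loudness `ν‖∇U‖²` by `A^{-3/2}`.
So a designer family only ever needs exactness MODULO the positive multiples of `f`. [folklore] -/
theorem ray_absorption {ν A : ℝ} (hA : 0 < A) {N : ℕ} {f U : 𝕋³ → E³}
    (hU : IsSteadyState ν N (A • f) U) :
    IsSteadyState (ν / Real.sqrt A) N f ((Real.sqrt A)⁻¹ • U) ∧
      ∫ x, ‖((Real.sqrt A)⁻¹ • U) x‖ ^ 2 = A⁻¹ * ∫ x, ‖U x‖ ^ 2 ∧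
      (ν / Real.sqrt A) * gradNormSq ((Real.sqrt A)⁻¹ • U) = (A * Real.sqrt A)⁻¹ * (ν * gradNormSq U) := by
  sorry

/-- **Ray Newton–Kantorovich** (finite-dimensional, bordered): let `Φ c = L c + B c c` with
`‖B c w‖ ≤ β‖c‖‖w‖`. If `(c₀, A₀)` is an approximate zero of `Ψ(c, A) := Φ c − A • f`,
`‖Φ c₀ − A₀ • f‖ ≤ η`, and the BORDERED derivative `(w, a) ↦ DΦ(c₀) w − a • f` has a right inverse of
norm `≤ M` (this is finite at folds of the branch in `A`, equivalently in `ν`), and `4 M² β η < 1`, then an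
EXACT point of the ray variety `{Φ c = A • f}` lies within `2Mη` of `(c₀, A₀)` (chord iteration
`d ↦ −R(Ψ(z₀) + B(d_c, d_c))` is a contraction of the `2Mη`-ball). [folklore] -/
theorem ray_newton {X : Type*} [NormedAddCommGroup X] [InnerProductSpace ℝ X] [FiniteDimensional ℝ X]
    (L : X →ₗ[ℝ] X) (B : X →ₗ[ℝ] X →ₗ[ℝ] X) (f c₀ : X) (A₀ η M β : ℝ)
    (hβ : ∀ c w, ‖B c w‖ ≤ β * ‖c‖ * ‖w‖) (hM : 0 ≤ M)
    (hR : ∀ w : X, ∃ v : X, ∃ t : ℝ, (L v + B c₀ v + B v c₀) - t • f = w ∧ ‖v‖ + |t| ≤ M * ‖w‖)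
    (hη : ‖(L c₀ + B c₀ c₀) - A₀ • f‖ ≤ η) (hsmall : 4 * M ^ 2 * β * η < 1) :
    ∃ c : X, ∃ A : ℝ, L c + B c c = A • f ∧ ‖c - c₀‖ ≤ 2 * M * η ∧ |A - A₀| ≤ 2 * M * η := by
  sorry

end Summit.AnomalousDissipation.AnomalousDissipation.Cruxes.GalerkinSteadyZerothLaw.Ideator1

end
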